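import Summits.AtomisticToContinuum.HydrodynamicLimit.Theorems.EnskogAdjointDualityCollisionResidualVanishesCutoffPathwise
import Summits.AtomisticToContinuum.HydrodynamicLimit.Theorems.EnskogAdjointDualityCollisionResidualVanishesCutoffMoments
import HarnessLib

/-!
# EnskogAdjointDuality / CollisionResidualVanishes — the `L²` duality assemblies under a velocity
# cutoff (cutoff toolkit T4)

Support theorem for the crux `Summit.AtomisticToContinuum.HydrodynamicLimit.Theses.EnskogAdjointDuality.CollisionResidualVanishes`
(K1, stmt-AtomisticToContinuum-14658, line `birth`, lead c6). The sibling crux `AdjointEnskogTestFamilyR`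
(K2R) is false AS TYPED (2026-08-17, `Cruxes/AdjointEnskogTestFamilyR/HyperVelocityObstruction.md`):
no admissible family has defect `|Dφ^N + L^Nφ^N| ≤ η_N(1+|v|²)` for ALL `v`. The repair asks the
defect bound only below the velocity cutoff `‖v‖ ≤ N + 1`, together with a crude global polynomial
bound `|Dφ^N + L^Nφ^N| ≤ C_g(1+|v|²)³`. This file re-proves the `L²` CONVERSE duality assembly
`residual_assembly` under these cutoff premises, with the same conclusion:

* on the event `{Σⱼ|vⱼ(0)|² ≤ (N+1)²}` every particle velocity stays below the cutoff along the orbit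
  (conserved kinetic energy), so the pathwise estimate `pathwise_residual_bound_cut` applies with `η_N`;
* on the complement the global bound gives the crude pathwise estimate `pathwise_residual_bound_poly`,
  whose extra term `C_g(1+Σⱼ|vⱼ|²)² t (1+e)` is absorbed by the Markov weight `(e/(N+1))³ ≥ 1` there
  (`e = (N+1)⁻¹Σⱼ|vⱼ|²`), giving a summand `≤ C_g² t² (N+1)⁻² (1+e)¹²` whose integral is `O((N+1)⁻²)` by
  the uniform moment bounds of every order (`exists_lintegral_one_add_energy_pow_flow_le`).

* `residual_assembly_cut` — the statement; `cutoff_residual_assembly` — its registered closed form.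

References: M. Pulvirenti, S. Simonella, arXiv:1504.03215, §2 [PulvirentiSimonella2016];
H. Spohn (1991), Part I §3.2 [Spohn1991].
-/

noncomputable section

open MeasureTheory Set Filter Topology Function
open scoped ENNReal BigOperators InnerProductSpace

namespace Summit.AtomisticToContinuum.HydrodynamicLimit.Theorems

open Literature.Analysis.FluidPDE Literature.MathematicalPhysics.KineticTheory

variable {a₀ θ₀ : T3 → ℝ} {u₀ : T3 → V3}

/-- `(a + b + c + d + e + g)² ≤ 6 (a² + b² + c² + d² + e² + g²)`. [folklore] -/
private theorem sq_add_six_le (a b c d e g : ℝ) :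
    (a + b + c + d + e + g) ^ 2 ≤ 6 * (a ^ 2 + b ^ 2 + c ^ 2 + d ^ 2 + e ^ 2 + g ^ 2) := by
  nlinarith [sq_nonneg (a - b), sq_nonneg (a - c), sq_nonneg (a - d), sq_nonneg (a - e),
    sq_nonneg (a - g), sq_nonneg (b - c), sq_nonneg (b - d), sq_nonneg (b - e), sq_nonneg (b - g),
    sq_nonneg (c - d), sq_nonneg (c - e), sq_nonneg (c - g), sq_nonneg (d - e), sq_nonneg (d - g),
    sq_nonneg (e - g)]

/-- Real sequences tending to `0` have `ENNReal.ofReal` of their squares tending to `0`.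
[folklore] -/
private theorem tendsto_ofReal_sq_of_tendsto_zero' {g : ℕ → ℝ} (hg : Tendsto g atTop (𝓝 0)) :
    Tendsto (fun N => ENNReal.ofReal (g N ^ 2)) atTop (𝓝 0) := by
  have h : Tendsto (fun N => g N ^ 2) atTop (𝓝 0) := by simpa using hg.pow 2
  simpa using ENNReal.tendsto_ofReal h

/-- **The large-energy weight.** With `S = Σⱼ|vⱼ|²`, `e = (N+1)⁻¹ S` and `(N+1)² < S`: the crude
term `C_g (1+S)² t (1+e)` of `pathwise_residual_bound_poly` is at most
`C_g t (N+1)⁻¹ (1+e)⁶` (indeed `1 + S ≤ (N+1)(1+e)` and `1 ≤ e/(N+1)`, so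
`(1+S)²(1+e) ≤ (N+1)²(1+e)³ (e/(N+1))³ ≤ (N+1)⁻¹ (1+e)⁶`). [folklore] -/
theorem poly_term_le_weight {n S Cg t : ℝ} (hn : 1 ≤ n) (hS : n ^ 2 < S) (hCg : 0 ≤ Cg)
    (ht : 0 ≤ t) :
    Cg * (1 + S) ^ 2 * t * (1 + n⁻¹ * S) ≤ Cg * t * n⁻¹ * (1 + n⁻¹ * S) ^ 6 := by
  have hn0 : 0 < n := by linarith
  set e : ℝ := n⁻¹ * S with he
  have hSe : S = n * e := by rw [he, ← mul_assoc, mul_inv_cancel₀ hn0.ne', one_mul]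
  have he1 : n ≤ e := by
    -- `n² < S = n e` gives `n < e`
    have : n * n < n * e := by nlinarith
    exact (lt_of_mul_lt_mul_left this hn0.le).le
  have he0 : 0 ≤ e := hn0.le.trans he1
  have h1S : 1 + S ≤ n * (1 + e) := by rw [hSe]; nlinarith
  have h1S0 : 0 ≤ 1 + S := by nlinarith
  -- `(1+S)² ≤ n²(1+e)²`
  have hsq : (1 + S) ^ 2 ≤ n ^ 2 * (1 + e) ^ 2 := by
    calc (1 + S) ^ 2 ≤ (n * (1 + e)) ^ 2 := pow_le_pow_left₀ h1S0 h1S 2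
      _ = n ^ 2 * (1 + e) ^ 2 := by ring
  -- `n³ ≤ e³ ≤ (1+e)³`
  have hcube : n ^ 3 ≤ (1 + e) ^ 3 := pow_le_pow_left₀ hn0.le (by linarith) 3
  -- combine: `(1+S)²(1+e) · n ≤ n² (1+e)³ · n = n³ (1+e)³ ≤ (1+e)⁶`
  have hkey : (1 + S) ^ 2 * (1 + e) * n ≤ (1 + e) ^ 6 := by
    have h1e : 0 ≤ 1 + e := by linarith
    calc (1 + S) ^ 2 * (1 + e) * n ≤ n ^ 2 * (1 + e) ^ 2 * (1 + e) * n := by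
          gcongr
      _ = n ^ 3 * (1 + e) ^ 3 := by ring
      _ ≤ (1 + e) ^ 3 * (1 + e) ^ 3 := by gcongr
      _ = (1 + e) ^ 6 := by ring
  -- divide by `n`
  have hdiv : (1 + S) ^ 2 * (1 + e) ≤ n⁻¹ * (1 + e) ^ 6 := by
    rw [← le_div_iff₀ hn0] at hkey
    rwa [div_eq_inv_mul] at hkey
  calc Cg * (1 + S) ^ 2 * t * (1 + e) = Cg * t * ((1 + S) ^ 2 * (1 + e)) := by ring
    _ ≤ Cg * t * (n⁻¹ * (1 + e) ^ 6) := by gcongr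
    _ = Cg * t * n⁻¹ * (1 + e) ^ 6 := by ring

/-- **The `L²` converse of the duality assembly under a velocity cutoff.** As `residual_assembly`
(test functions `φ^N`, kernels `L^N` of growth `(1+|v|²)²`, Euler weight `f`; (c) Enskog defect of `f`
tested on the family `→ 0`; (d) `I₃ + ½I₂ → 0`; (e) the `t = 0` term `→ 0` in `L²`; (b') the tested
hydrodynamic quantity at time `t` converges in `L²`), but with the regularity/defect premise (a) in
CUTOFF form: `C¹` along free flight and `|Dφ^N + L^Nφ^N| ≤ η_N(1+|v|²)` only for `‖v‖ ≤ N + 1`,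
eventually, `η_N → 0`, plus a global polynomial bound `|Dφ^N + L^Nφ^N| ≤ C_g(1+|v|²)³`. Conclusion
unchanged: `∫ R_N² dP_N → 0` under the local Gibbs laws (`σ ≤ 1/2`). Proof: below the energy event
`Σⱼ|vⱼ|² ≤ (N+1)²` the pathwise estimate `pathwise_residual_bound_cut`; above it
`pathwise_residual_bound_poly` and the Markov weight `(e/(N+1))³`, paid by the twelfth moment of
`1 + e` (`exists_lintegral_one_add_energy_pow_flow_le`). [cite: PulvirentiSimonella2016, §2] -/
theorem residual_assembly_cut (ha : Continuous a₀) (hθ : Continuous θ₀) (hu : Continuous u₀)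
    (ha0 : ∀ x, 0 < a₀ x) (hθ0 : ∀ x, 0 < θ₀ x) {σ : ℝ} (hσ : σ ≤ 1 / 2)
    (Φ : (N : ℕ) → HardSphereFlow (Torus.geometry (Fin 3)) (hsDiameter σ N) (N + 1))
    {t : ℝ} (ht : 0 < t)
    (φ L : ℕ → ℝ → T3 → V3 → ℝ) (f : ℝ → T3 → V3 → ℝ)
    (Rres : (N : ℕ) → Config (N + 1) (Fin 3) T3 → ℝ)
    (hφc : ∀ N, Continuous fun p : ℝ × T3 × V3 => φ N p.1 p.2.1 p.2.2)
    (hreg : ∃ η : ℕ → ℝ, Tendsto η atTop (𝓝 0) ∧ ∃ Cg : ℝ, ∀ᶠ N in atTop,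
      (∀ x v, ContDiffOn ℝ 1
        (fun r => φ N r ((Torus.geometry (Fin 3)).translate x (r • v)) v) (Icc 0 t)) ∧
      (∀ s ∈ Icc 0 t, ∀ x v, ‖v‖ ≤ (N : ℝ) + 1 →
        |derivWithin (fun r => φ N r ((Torus.geometry (Fin 3)).translate x ((r - s) • v)) v)
            (Icc 0 t) s + L N s x v| ≤ η N * (1 + ‖v‖ ^ 2)) ∧
      (∀ s ∈ Icc 0 t, ∀ x v,
        |derivWithin (fun r => φ N r ((Torus.geometry (Fin 3)).translate x ((r - s) • v)) v)
            (Icc 0 t) s + L N s x v| ≤ Cg * (1 + ‖v‖ ^ 2) ^ 3))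
    (hL : ∀ N, ∃ K : ℝ, (∀ s ∈ Icc 0 t, ∀ x v, |L N s x v| ≤ K * (1 + ‖v‖ ^ 2) ^ 2) ∧
      Measurable fun p : ℝ × T3 × V3 => L N (max 0 (min t p.1)) p.2.1 p.2.2)
    (hR : ∀ N z, Rres N z = ((N : ℝ) + 1)⁻¹ *
        (∑ᶠ (s : ℝ) (_ : s ∈ collisionTimes (Torus.geometry (Fin 3)) (hsDiameter σ N)
            (fun r => (Φ N).flow r z) ∩ Ioc 0 t),
          ∑ i : Fin (N + 1), ∑ j : Fin (N + 1),
            (if i ≠ j ∧ ‖(Torus.geometry (Fin 3)).sepVec ((Φ N).flow s z i).1 ((Φ N).flow s z j).1‖ =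
                hsDiameter σ N then
              φ N s ((Φ N).flow s z i).1 ((Φ N).flow s z i).2 -
                φ N s ((Φ N).flow s z i).1
                  (reflectVel ((Torus.geometry (Fin 3)).sepVec ((Φ N).flow s z i).1 ((Φ N).flow s z j).1)
                    (((Φ N).flow s z i).2, ((Φ N).flow s z j).2)).1
            else 0)) -
        (∫ s in Icc 0 t, ∫ y, L N s y.1 y.2 ∂(empiricalMeasure ((Φ N).flow s z))) +
        (1 / 2 : ℝ) * ∫ s in Icc 0 t, ∫ x, ∫ v, f s x v * L N s x v)
    (hAt : Tendsto (fun N => ∫⁻ z, ENNReal.ofReal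
      ((((N : ℝ) + 1)⁻¹ * (∑ i, φ N t ((Φ N).flow t z i).1 ((Φ N).flow t z i).2) -
        ∫ x, ∫ v, f t x v * φ N t x v) ^ 2)
      ∂localGibbsLaw σ a₀ u₀ θ₀ N (Φ N)) atTop (𝓝 0))
    (hRes : Tendsto (fun N => (∫ x, ∫ v, f t x v * φ N t x v) - (∫ x, ∫ v, f 0 x v * φ N 0 x v) -
      ∫ s in Icc 0 t, ∫ x, ∫ v, f s x v *
        (derivWithin (fun r => φ N r ((Torus.geometry (Fin 3)).translate x ((r - s) • v)) v)
          (Icc 0 t) s + (1 / 2 : ℝ) * L N s x v)) atTop (𝓝 0))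
    (hF : Tendsto (fun N => (∫ s in Icc 0 t, ∫ x, ∫ v, f s x v *
        (derivWithin (fun r => φ N r ((Torus.geometry (Fin 3)).translate x ((r - s) • v)) v)
          (Icc 0 t) s + (1 / 2 : ℝ) * L N s x v)) +
      (1 / 2 : ℝ) * ∫ s in Icc 0 t, ∫ x, ∫ v, f s x v * L N s x v) atTop (𝓝 0))
    (h0 : Tendsto (fun N => ∫⁻ z, ENNReal.ofReal
      ((((N : ℝ) + 1)⁻¹ * (∑ i, φ N 0 (z i).1 (z i).2) - ∫ x, ∫ v, f 0 x v * φ N 0 x v) ^ 2)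
      ∂localGibbsLaw σ a₀ u₀ θ₀ N (Φ N)) atTop (𝓝 0)) :
    Tendsto (fun N => ∫⁻ z, ENNReal.ofReal (Rres N z ^ 2)
      ∂localGibbsLaw σ a₀ u₀ θ₀ N (Φ N)) atTop (𝓝 0) := by
  obtain ⟨η, hη, Cg, hev⟩ := hreg
  haveI hP : ∀ N, IsProbabilityMeasure (localGibbsLaw σ a₀ u₀ θ₀ N (Φ N)) := fun N =>
    isProbabilityMeasure_localGibbsLaw ha hθ hu ha0 hθ0 hσ N (Φ N)
  -- the conserved-energy moment bounds (orders 2 and 12), flow-free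
  obtain ⟨Cm, hCm0, hCm⟩ := exists_lintegral_one_add_energy_pow_flow_le ha hθ hu ha0 hθ0 hσ 12
  have hmomk : ∀ (N : ℕ) (k : ℕ), k ≤ 12 →
      ∫⁻ z, ENNReal.ofReal ((1 + ((N + 1 : ℕ) : ℝ)⁻¹ * ∑ i, ‖(z i).2‖ ^ 2) ^ k)
        ∂localGibbsLaw σ a₀ u₀ θ₀ N (Φ N) ≤ ENNReal.ofReal Cm := by
    intro N k hk
    have hgood : ∀ᵐ z ∂localGibbsLaw σ a₀ u₀ θ₀ N (Φ N), z ∈ (Φ N).good :=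
      mem_ae_iff.2 (localGibbsLaw_compl_good_eq_zero (Φ N))
    calc ∫⁻ z, ENNReal.ofReal ((1 + ((N + 1 : ℕ) : ℝ)⁻¹ * ∑ i, ‖(z i).2‖ ^ 2) ^ k)
          ∂localGibbsLaw σ a₀ u₀ θ₀ N (Φ N)
        = ∫⁻ z, ENNReal.ofReal ((1 + ((N + 1 : ℕ) : ℝ)⁻¹ * ∑ i, ‖((Φ N).flow 0 z i).2‖ ^ 2) ^ k)
          ∂localGibbsLaw σ a₀ u₀ θ₀ N (Φ N) := by
          refine lintegral_congr_ae ?_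
          filter_upwards [hgood] with z hz
          rw [(Φ N).flow_zero z hz]
      _ ≤ ENNReal.ofReal Cm := hCm N (Φ N) 0 k hk
  -- nonnegativity of the global constant (from the global bound at `s = 0`, `v = 0`, eventually)
  -- names for the scalar sequences
  set fs : ℕ → ℝ := fun N => (∫ s in Icc 0 t, ∫ x, ∫ v, f s x v *
      (derivWithin (fun r => φ N r ((Torus.geometry (Fin 3)).translate x ((r - s) • v)) v)
        (Icc 0 t) s + (1 / 2 : ℝ) * L N s x v)) +
    (1 / 2 : ℝ) * ∫ s in Icc 0 t, ∫ x, ∫ v, f s x v * L N s x v with hfs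
  set res : ℕ → ℝ := fun N => (∫ x, ∫ v, f t x v * φ N t x v) - (∫ x, ∫ v, f 0 x v * φ N 0 x v) -
      ∫ s in Icc 0 t, ∫ x, ∫ v, f s x v *
        (derivWithin (fun r => φ N r ((Torus.geometry (Fin 3)).translate x ((r - s) • v)) v)
          (Icc 0 t) s + (1 / 2 : ℝ) * L N s x v) with hres
  set w : ℕ → ℝ := fun N => Cg * t * ((N : ℝ) + 1)⁻¹ with hw
  have hwlim : Tendsto w atTop (𝓝 0) := by
    have h1 : Tendsto (fun N : ℕ => ((N : ℝ) + 1)⁻¹) atTop (𝓝 0) :=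
      tendsto_inv_atTop_zero.comp (tendsto_natCast_atTop_atTop.atTop_add tendsto_const_nhds)
    simpa [hw] using h1.const_mul (Cg * t)
  -- the dominating sequence
  set G : ℕ → ℝ≥0∞ := fun N => ENNReal.ofReal 6 *
    ((∫⁻ z, ENNReal.ofReal
        ((((N : ℝ) + 1)⁻¹ * (∑ i, φ N t ((Φ N).flow t z i).1 ((Φ N).flow t z i).2) -
          ∫ x, ∫ v, f t x v * φ N t x v) ^ 2) ∂localGibbsLaw σ a₀ u₀ θ₀ N (Φ N)) +
      ((∫⁻ z, ENNReal.ofReal ((((N : ℝ) + 1)⁻¹ * (∑ i, φ N 0 (z i).1 (z i).2) -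
        ∫ x, ∫ v, f 0 x v * φ N 0 x v) ^ 2) ∂localGibbsLaw σ a₀ u₀ θ₀ N (Φ N)) +
      (ENNReal.ofReal ((η N * t) ^ 2) * ENNReal.ofReal Cm +
      (ENNReal.ofReal (fs N ^ 2) + (ENNReal.ofReal (res N ^ 2) +
        ENNReal.ofReal (w N ^ 2) * ENNReal.ofReal Cm))))) with hG
  have hGlim : Tendsto G atTop (𝓝 0) := by
    have h2 : Tendsto (fun N => ENNReal.ofReal ((η N * t) ^ 2) * ENNReal.ofReal Cm) atTop (𝓝 0) := by
      have := ENNReal.Tendsto.mul_const (tendsto_ofReal_sq_of_tendsto_zero' (by simpa using hη.mul_const t))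
        (Or.inr ENNReal.ofReal_ne_top : (0 : ℝ≥0∞) ≠ 0 ∨ ENNReal.ofReal Cm ≠ ⊤)
      simpa using this
    have h3 : Tendsto (fun N => ENNReal.ofReal (fs N ^ 2)) atTop (𝓝 0) :=
      tendsto_ofReal_sq_of_tendsto_zero' hF
    have h4 : Tendsto (fun N => ENNReal.ofReal (res N ^ 2)) atTop (𝓝 0) :=
      tendsto_ofReal_sq_of_tendsto_zero' hRes
    have h5 : Tendsto (fun N => ENNReal.ofReal (w N ^ 2) * ENNReal.ofReal Cm) atTop (𝓝 0) := by
      have := ENNReal.Tendsto.mul_const (tendsto_ofReal_sq_of_tendsto_zero' hwlim)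
        (Or.inr ENNReal.ofReal_ne_top : (0 : ℝ≥0∞) ≠ 0 ∨ ENNReal.ofReal Cm ≠ ⊤)
      simpa using this
    have hsum := hAt.add (h0.add (h2.add (h3.add (h4.add h5))))
    simp only [add_zero] at hsum
    have := ENNReal.Tendsto.const_mul hsum (Or.inr ENNReal.ofReal_ne_top :
      (0 : ℝ≥0∞) ≠ 0 ∨ ENNReal.ofReal 6 ≠ ⊤)
    simpa [hG] using this
  -- eventually the pathwise estimates apply
  refine tendsto_of_tendsto_of_tendsto_of_le_of_le' tendsto_const_nhds hGlim
    (Eventually.of_forall fun N => bot_le) ?_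
  filter_upwards [hev] with N hN
  obtain ⟨hC1, hdef, hdefg⟩ := hN
  obtain ⟨K, hKb, hKm⟩ := hL N
  have hη0 : 0 ≤ η N := by
    have h := (abs_nonneg _).trans (hdef 0 ⟨le_rfl, ht.le⟩ 0 0 (by rw [norm_zero]; positivity))
    simpa using h
  have hCg0 : 0 ≤ Cg := by
    have h := (abs_nonneg _).trans (hdefg 0 ⟨le_rfl, ht.le⟩ 0 0)
    have h1 : (0 : ℝ) ≤ Cg * 1 := by simpa using h
    linarith
  set n : ℝ := (N : ℝ) + 1 with hn
  have hn' : ((N + 1 : ℕ) : ℝ) = n := by rw [hn]; push_cast; ring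
  have hn1 : 1 ≤ n := by rw [hn]; linarith [(Nat.cast_nonneg N : (0 : ℝ) ≤ N)]
  have hnpos : 0 < n := by linarith
  set B0 : ℝ := ∫ x, ∫ v, f 0 x v * φ N 0 x v with hB0
  set Bt : ℝ := ∫ x, ∫ v, f t x v * φ N t x v with hBt
  set X0 : Config (N + 1) (Fin 3) T3 → ℝ := fun z =>
    n⁻¹ * (∑ i, φ N 0 (z i).1 (z i).2) - B0 with hX0
  set Xt : Config (N + 1) (Fin 3) T3 → ℝ := fun z =>
    n⁻¹ * (∑ i, φ N t ((Φ N).flow t z i).1 ((Φ N).flow t z i).2) - Bt with hXt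
  set en : Config (N + 1) (Fin 3) T3 → ℝ := fun z =>
    ((N + 1 : ℕ) : ℝ)⁻¹ * ∑ i, ‖(z i).2‖ ^ 2 with hen
  -- pointwise a.e. bound
  have hgood : ∀ᵐ z ∂localGibbsLaw σ a₀ u₀ θ₀ N (Φ N), z ∈ (Φ N).good :=
    mem_ae_iff.2 (localGibbsLaw_compl_good_eq_zero (Φ N))
  have hpt : ∀ᵐ z ∂localGibbsLaw σ a₀ u₀ θ₀ N (Φ N),
      ENNReal.ofReal (Rres N z ^ 2) ≤
        ENNReal.ofReal 6 * (ENNReal.ofReal (Xt z ^ 2) + (ENNReal.ofReal (X0 z ^ 2) +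
          (ENNReal.ofReal ((η N * t) ^ 2) * ENNReal.ofReal ((1 + en z) ^ 2) +
          (ENNReal.ofReal (fs N ^ 2) + (ENNReal.ofReal (res N ^ 2) +
            ENNReal.ofReal (w N ^ 2) * ENNReal.ofReal ((1 + en z) ^ 12)))))) := by
    filter_upwards [hgood] with z hz
    have hLint := integrableOn_enskogL_orbit (Φ N) hz (L N) hKb hKm
    set S : ℝ := ∑ j, ‖(z j).2‖ ^ 2 with hS
    have hS0 : 0 ≤ S := by positivity
    have hen0 : 0 ≤ en z := by positivity
    have henS : en z = n⁻¹ * S := by simp only [hen, hn', hS]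
    -- the combined pathwise bound, valid on and off the energy event
    have hcomb : |Rres N z| ≤ |Xt z| + |X0 z| + η N * t * (1 + en z) + |fs N| + |res N| +
        w N * (1 + en z) ^ 6 := by
      by_cases hSle : S ≤ n ^ 2
      · -- below the energy event: the cutoff premise covers every `‖v‖² ≤ S`
        have hDL : ∀ s ∈ Icc 0 t, ∀ x v, ‖v‖ ^ 2 ≤ ∑ j, ‖(z j).2‖ ^ 2 →
            |derivWithin (fun r => φ N r ((Torus.geometry (Fin 3)).translate x ((r - s) • v)) v)
              (Icc 0 t) s + L N s x v| ≤ η N * (1 + ‖v‖ ^ 2) := by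
          intro s hs x v hv
          refine hdef s hs x v ?_
          have hv2 : ‖v‖ ^ 2 ≤ n ^ 2 := hv.trans hSle
          exact (pow_le_pow_iff_left₀ (norm_nonneg v) hnpos.le two_ne_zero).1 hv2
        have hpw := pathwise_residual_bound_cut (Φ N) hz ht (φ N) (L N) hC1 hDL hLint
          (Rz := Rres N z) (Res := res N) (I₂ := ∫ s in Icc 0 t, ∫ x, ∫ v, f s x v * L N s x v)
          (I₃ := ∫ s in Icc 0 t, ∫ x, ∫ v, f s x v *
            (derivWithin (fun r => φ N r ((Torus.geometry (Fin 3)).translate x ((r - s) • v)) v)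
              (Icc 0 t) s + (1 / 2 : ℝ) * L N s x v)) (Bt := Bt) (B0 := B0) (hR N z)
          (by simp only [hres, hBt, hB0])
        have h1 : |Rres N z| ≤ |Xt z| + |X0 z| + η N * t * (1 + en z) + |fs N| + |res N| := by
          simpa only [hXt, hX0, hen, hfs] using hpw
        have hw0 : 0 ≤ w N * (1 + en z) ^ 6 := by
          have : 0 ≤ w N := by simp only [hw]; positivity
          positivity
        linarith
      · -- above the energy event: global polynomial bound + Markov weight
        rw [not_le] at hSle
        have hpw := pathwise_residual_bound_poly (Φ N) hz ht (φ N) (L N) hC1 hdefg hLint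
          (Rz := Rres N z) (Res := res N) (I₂ := ∫ s in Icc 0 t, ∫ x, ∫ v, f s x v * L N s x v)
          (I₃ := ∫ s in Icc 0 t, ∫ x, ∫ v, f s x v *
            (derivWithin (fun r => φ N r ((Torus.geometry (Fin 3)).translate x ((r - s) • v)) v)
              (Icc 0 t) s + (1 / 2 : ℝ) * L N s x v)) (Bt := Bt) (B0 := B0) (hR N z)
          (by simp only [hres, hBt, hB0])
        have h1 : |Rres N z| ≤ |Xt z| + |X0 z| + Cg * (1 + S) ^ 2 * t * (1 + en z) + |fs N| +
            |res N| := by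
          simpa only [hXt, hX0, hen, hfs, hS] using hpw
        have hwt : Cg * (1 + S) ^ 2 * t * (1 + en z) ≤ w N * (1 + en z) ^ 6 := by
          rw [henS]
          simpa only [hw] using poly_term_le_weight hn1 hSle hCg0 ht.le
        have hηt : 0 ≤ η N * t * (1 + en z) := by positivity
        linarith
    have hsq : Rres N z ^ 2 ≤
        6 * (Xt z ^ 2 + X0 z ^ 2 + (η N * t) ^ 2 * (1 + en z) ^ 2 + fs N ^ 2 + res N ^ 2 +
          w N ^ 2 * (1 + en z) ^ 12) := by
      have hrhs0 : 0 ≤ |Xt z| + |X0 z| + η N * t * (1 + en z) + |fs N| + |res N| +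
          w N * (1 + en z) ^ 6 := (abs_nonneg _).trans hcomb
      calc Rres N z ^ 2 = |Rres N z| ^ 2 := (sq_abs _).symm
        _ ≤ (|Xt z| + |X0 z| + η N * t * (1 + en z) + |fs N| + |res N| + w N * (1 + en z) ^ 6) ^ 2 :=
            pow_le_pow_left₀ (abs_nonneg _) hcomb 2
        _ ≤ 6 * (|Xt z| ^ 2 + |X0 z| ^ 2 + (η N * t * (1 + en z)) ^ 2 + |fs N| ^ 2 + |res N| ^ 2 +
            (w N * (1 + en z) ^ 6) ^ 2) := sq_add_six_le _ _ _ _ _ _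
        _ = 6 * (Xt z ^ 2 + X0 z ^ 2 + (η N * t) ^ 2 * (1 + en z) ^ 2 + fs N ^ 2 + res N ^ 2 +
            w N ^ 2 * (1 + en z) ^ 12) := by
            simp only [sq_abs]; ring
    calc ENNReal.ofReal (Rres N z ^ 2)
        ≤ ENNReal.ofReal (6 * (Xt z ^ 2 + X0 z ^ 2 + (η N * t) ^ 2 * (1 + en z) ^ 2 + fs N ^ 2 +
            res N ^ 2 + w N ^ 2 * (1 + en z) ^ 12)) := ENNReal.ofReal_le_ofReal hsq
      _ = _ := by
          rw [ENNReal.ofReal_mul (by norm_num), ENNReal.ofReal_add (by positivity) (by positivity),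
            ENNReal.ofReal_add (by positivity) (by positivity),
            ENNReal.ofReal_add (by positivity) (by positivity),
            ENNReal.ofReal_add (by positivity) (by positivity),
            ENNReal.ofReal_add (by positivity) (by positivity), ENNReal.ofReal_mul (by positivity),
            ENNReal.ofReal_mul (by positivity)]
          ring
  -- measurability of the summands that need it
  have hcoord : ∀ i : Fin (N + 1), Measurable fun w : Config (N + 1) (Fin 3) T3 => w i :=
    fun i => measurable_pi_apply i
  have hXtm : Measurable fun z => ENNReal.ofReal (Xt z ^ 2) := by
    have hsumm : Measurable fun w : Config (N + 1) (Fin 3) T3 => ∑ i, φ N t (w i).1 (w i).2 := by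
      refine Finset.measurable_sum _ fun i _ => ?_
      exact (hφc N).measurable.comp (measurable_const.prodMk
        ((hcoord i).fst.prodMk (hcoord i).snd))
    have hm : Measurable Xt :=
      ((hsumm.comp ((Φ N).measurable_flow t)).const_mul _).sub measurable_const
    exact (hm.pow_const 2).ennreal_ofReal
  have hX0m : Measurable fun z => ENNReal.ofReal (X0 z ^ 2) := by
    have hm : Measurable X0 := by
      refine (Measurable.const_mul ?_ _).sub measurable_const
      refine Finset.measurable_sum _ fun i _ => ?_
      exact (hφc N).measurable.comp (measurable_const.prodMk
        ((hcoord i).fst.prodMk (hcoord i).snd))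
    exact (hm.pow_const 2).ennreal_ofReal
  have henmeas : Measurable en := by
    refine Measurable.const_mul ?_ _
    exact Finset.measurable_sum _ fun i _ => ((hcoord i).snd.norm).pow_const 2
  have henm : Measurable fun z => ENNReal.ofReal ((η N * t) ^ 2) * ENNReal.ofReal ((1 + en z) ^ 2) :=
    (((measurable_const.add henmeas).pow_const 2).ennreal_ofReal).const_mul _
  have hfsm : Measurable fun _z : Config (N + 1) (Fin 3) T3 => ENNReal.ofReal (fs N ^ 2) :=
    measurable_const
  have hresm : Measurable fun _z : Config (N + 1) (Fin 3) T3 => ENNReal.ofReal (res N ^ 2) :=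
    measurable_const
  -- integrate
  calc ∫⁻ z, ENNReal.ofReal (Rres N z ^ 2) ∂localGibbsLaw σ a₀ u₀ θ₀ N (Φ N)
      ≤ ∫⁻ z, ENNReal.ofReal 6 * (ENNReal.ofReal (Xt z ^ 2) + (ENNReal.ofReal (X0 z ^ 2) +
          (ENNReal.ofReal ((η N * t) ^ 2) * ENNReal.ofReal ((1 + en z) ^ 2) +
          (ENNReal.ofReal (fs N ^ 2) + (ENNReal.ofReal (res N ^ 2) +
            ENNReal.ofReal (w N ^ 2) * ENNReal.ofReal ((1 + en z) ^ 12))))))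
          ∂localGibbsLaw σ a₀ u₀ θ₀ N (Φ N) := lintegral_mono_ae hpt
    _ = ENNReal.ofReal 6 * ((∫⁻ z, ENNReal.ofReal (Xt z ^ 2) ∂localGibbsLaw σ a₀ u₀ θ₀ N (Φ N)) +
          ((∫⁻ z, ENNReal.ofReal (X0 z ^ 2) ∂localGibbsLaw σ a₀ u₀ θ₀ N (Φ N)) +
          (ENNReal.ofReal ((η N * t) ^ 2) *
              ∫⁻ z, ENNReal.ofReal ((1 + en z) ^ 2) ∂localGibbsLaw σ a₀ u₀ θ₀ N (Φ N) +
          (ENNReal.ofReal (fs N ^ 2) + (ENNReal.ofReal (res N ^ 2) +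
            ENNReal.ofReal (w N ^ 2) *
              ∫⁻ z, ENNReal.ofReal ((1 + en z) ^ 12) ∂localGibbsLaw σ a₀ u₀ θ₀ N (Φ N)))))) := by
        rw [lintegral_const_mul' _ _ ENNReal.ofReal_ne_top, lintegral_add_left hXtm,
          lintegral_add_left hX0m, lintegral_add_left henm,
          lintegral_const_mul' _ _ ENNReal.ofReal_ne_top,
          lintegral_add_left hfsm, lintegral_add_left hresm, lintegral_const, lintegral_const,
          measure_univ, mul_one, mul_one, lintegral_const_mul' _ _ ENNReal.ofReal_ne_top]
    _ ≤ G N := by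
        simp only [hG]
        gcongr
        · exact hmomk N 2 (by norm_num)
        · exact hmomk N 12 le_rfl

/-- **Registered form** (sub-goal `cutoff_residual_assembly` of the crux stmt-AtomisticToContinuum-14658, line `birth`): `residual_assembly_cut` as a closed `∀`-statement — the `L²` converse of the duality assembly with the defect premise in velocity-cutoff form. [cite: PulvirentiSimonella2016, §2] -/
theorem cutoff_residual_assembly : ∀ {a₀ θ₀ : T3 → ℝ} {u₀ : T3 → V3} (ha : Continuous a₀) (hθ : Continuous θ₀) (hu : Continuous u₀) (ha0 : ∀ x, 0 < a₀ x) (hθ0 : ∀ x, 0 < θ₀ x) {σ : ℝ} (hσ : σ ≤ 1 / 2) (Φ : (N : ℕ) → HardSphereFlow (Torus.geometry (Fin 3)) (hsDiameter σ N) (N + 1)) {t : ℝ} (ht : 0 < t) (φ L : ℕ → ℝ → T3 → V3 → ℝ) (f : ℝ → T3 → V3 → ℝ) (Rres : (N : ℕ) → Config (N + 1) (Fin 3) T3 → ℝ) (hφc : ∀ N, Continuous fun p : ℝ × T3 × V3 => φ N p.1 p.2.1 p.2.2) (hreg : ∃ η : ℕ → ℝ, Tendsto η atTop (𝓝 0)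 ∧ ∃ Cg : ℝ, ∀ᶠ N in atTop, (∀ x v, ContDiffOn ℝ 1 (fun r => φ N r ((Torus.geometry (Fin 3)).translate x (r • v)) v) (Icc 0 t)) ∧ (∀ s ∈ Icc 0 t, ∀ x v, ‖v‖ ≤ (N : ℝ) + 1 → |derivWithin (fun r => φ N r ((Torus.geometry (Fin 3)).translate x ((r - s) • v)) v) (Icc 0 t) s + L N s x v| ≤ η N * (1 + ‖v‖ ^ 2)) ∧ (∀ s ∈ Icc 0 t, ∀ x v, |derivWithin (fun r => φ N r ((Torus.geometry (Fin 3)).translate x ((r - s) • v)) v) (Icc 0 t) s + L N s x v| ≤ Cg * (1 + ‖v‖ ^ 2) ^ 3)) (hL : ∀ N, ∃ K : ℝ, (∀ s ∈ Icc 0 t, ∀ x v, |L N s x v| ≤ K * (1 + ‖v‖ ^ 2) ^ 2) ∧ Measurable fun p : ℝ × T3 × V3 => L N (max 0 (min t p.1)) p.2.1 p.2.2) (hR : ∀ N z, Rres N z = ((N : ℝ) + 1)⁻¹ * (∑ᶠ (s : ℝ) (_ : s ∈ collisionTimes (Torus.geometry (Fin 3)) (hsDiameter σ N) (fun r => (Φ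 N).flow r z) ∩ Ioc 0 t), ∑ i : Fin (N + 1), ∑ j : Fin (N + 1), (if i ≠ j ∧ ‖(Torus.geometry (Fin 3)).sepVec ((Φ N).flow s z i).1 ((Φ N).flow s z j).1‖ = hsDiameter σ N then φ N s ((Φ N).flow s z i).1 ((Φ N).flow s z i).2 - φ N s ((Φ N).flow s z i).1 (reflectVel ((Torus.geometry (Fin 3)).sepVec ((Φ N).flow s z i).1 ((Φ N).flow s z j).1) (((Φ N).flow s z i).2, ((Φ N).flow s z j).2)).1 else 0)) - (∫ s in Icc 0 t, ∫ y, L N s y.1 y.2 ∂(empiricalMeasure ((Φ N).flow s z))) + (1 / 2 : ℝ) * ∫ s in Icc 0 t, ∫ x, ∫ v, f s x v * L N s x v) (hAt : Tendsto (fun N => ∫⁻ z, ENNReal.ofReal ((((N : ℝ) + 1)⁻¹ * (∑ i, φ N t ((Φ N).flow t z i).1 ((Φ N).flow t z i).2) - ∫ x, ∫ v, f t x v * φ N t x v) ^ 2) ∂localGibbsLaw σ a₀ u₀ θ₀ N (Φ N)) atTop (𝓝 0)) (hRes : Tendsto (fun N => (∫ x, ∫ v, f t x v * φ N t x v) - (∫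 x, ∫ v, f 0 x v * φ N 0 x v) - ∫ s in Icc 0 t, ∫ x, ∫ v, f s x v * (derivWithin (fun r => φ N r ((Torus.geometry (Fin 3)).translate x ((r - s) • v)) v) (Icc 0 t) s + (1 / 2 : ℝ) * L N s x v)) atTop (𝓝 0)) (hF : Tendsto (fun N => (∫ s in Icc 0 t, ∫ x, ∫ v, f s x v * (derivWithin (fun r => φ N r ((Torus.geometry (Fin 3)).translate x ((r - s) • v)) v) (Icc 0 t) s + (1 / 2 : ℝ) * L N s x v)) + (1 / 2 : ℝ) * ∫ s in Icc 0 t, ∫ x, ∫ v, f s x v * L N s x v) atTop (𝓝 0)) (h0 : Tendsto (fun N => ∫⁻ z, ENNReal.ofReal ((((N : ℝ) + 1)⁻¹ * (∑ i, φ N 0 (z i).1 (z i).2) - ∫ x, ∫ v, f 0 x v * φ N 0 x v) ^ 2) ∂localGibbsLaw σ a₀ u₀ θ₀ N (Φ N)) atTop (𝓝 0)), Tendsto (fun N => ∫⁻ z, ENNReal.ofReal (Rres N z ^ 2) ∂localGibbsLaw σ a₀ u₀ θ₀ N (Φ N)) atTop (𝓝 0) :=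
  @residual_assembly_cut

end Summit.AtomisticToContinuum.HydrodynamicLimit.Theorems

end
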